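import Summits.BirchSwinnertonDyer.BirchSwinnertonDyer.Theorems.SignedLowerHalvesSmallImageLowerHalfBothSignsRttD2J1CyclotomicCarrier
import Literature.NumberTheory.ComplexMultiplication.EllipticUnits.ImaginaryQuadraticMainConjectureCarriersGroupElt
import HarnessLib

/-!
# Route `SignedLowerHalves`, crux L `SmallImageLowerHalfBothSigns` (stmt-BirchSwinnertonDyer-23599), line `rtt_w3` v21 → v22 — E2, junction row J2⁺
# (THE LOCAL PACKAGE, bookkeeping): THE GROUP ELEMENTS `(1+T)^x ∈ Λ_𝒪 = 𝒪⟦T⟧` ACT ON honda's ONE-VARIABLE PINNED CARRIER `𝐇^i = I.H` LEVELWISE AS CONJUGATIONS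

INPUTS hand `bsd-inputs-honda-p1` g26 under LEAD `cruxlead-stmt-BirchSwinnertonDyer-23599` g12 (cell `bsd-ssimc`; BRIEF-E2 rev 6 §2 «J2⁺», MEMO v22-design stub S1);
helper `--supports stmt-BirchSwinnertonDyer-23599`. THEOREMS ONLY: no definition, no named fact, no instance, no `sorry`. The ONE-VARIABLE TWIN of honda g22's
`JohnsonLeungKings2011.IwasawaCohomologyDataO.proj_groupEltO_smul_eq_layerConjO` (two variables) for g23's `SmallImageRttD2J1.CycIwasawaCohomologyDataO`:
for every `p`-adic exponent `x`, the image of `(1+T)^x = binomialSeries ℤ_p x` in `Λ_𝒪` acts on the level `(n, k)` of `I.H` as `conj_γ^{x mod pⁿ}` (pin (P5)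
iterated + the congruence `(1+T)^x ≡ (1+T)^{x mod pⁿ} (mod (1+T)^{pⁿ} − 1)` + `(1+T)^{pⁿ} − 1` kills the level + continuity (P8)), hence as `conj_g` for EVERY
`g ∈ Γ_K` with `γ^{x mod pⁿ} g⁻¹ ∈ Gal(K̄/K_n)`; and for `γ` a generator up to a unit (`κ γ` a unit of `ℤ_p`) every `g` has such an exponent
(`x = (κ γ)⁻¹ · κ g`). This is how the Frobenius `[φ_w] ∈ Λ_𝒪` of the depletion factor `P_w = [φ_w] − u_w` is read on the levels (file `…RttJunctionFrobenius`).
HONEST FRAMING: bookkeeping; E2, crux L, crux M and BSD remain OPEN and are proved for NO curve.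

References: [JohnsonLeungKings2011] §4.1 Def. 4.1, §4.2 (arXiv p0012:L39–60, L80–112), §5.1; [Lang1990] Ch. 5 §1; [NeukirchSchmidtWingberg2008] (5.3.5);
[SerreLocalFields1979] VII §5 Prop. 3; [Washington1997] §13.2.
-/

set_option autoImplicit false
set_option linter.dupNamespace false -- D-0017: single-problem summit, the namespace repeats the problem name by design
noncomputable section

open scoped Classical
open NumberField IsDedekindDomain Field PowerSeries

namespace Summit.BirchSwinnertonDyer.BirchSwinnertonDyer.Theorems.SmallImageRttJunctionLocal

open Literature.NumberTheory.EllipticCurves Literature.NumberTheory.GaloisRepresentations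
  Literature.NumberTheory.ComplexMultiplication.EllipticUnits
  Literature.NumberTheory.ComplexMultiplication.EllipticUnits.JohnsonLeungKings2011
  Summit.BirchSwinnertonDyer.BirchSwinnertonDyer.Theorems.SmallImageRttD2J1

section Binomial

variable {K : Type} [Field K] [NumberField K] {p : ℕ} [Fact p.Prime] {S : Set (PadicAlgCl p)} {κ : ZpExtension K p}
  {γ : absoluteGaloisGroup K} {θ : absoluteGaloisGroup K →ₜ* (padicCoeffIntegers S)ˣ} {P : Set (HeightOneSpectrum (𝓞 K))} {i : ℕ}
  (I : CycIwasawaCohomologyDataO S κ γ θ P i)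

/-- **`(1+T)^j` acts on the level `(n,k)` as `conj_γ^j`** ((P5) iterated). [cite: JohnsonLeungKings2011, §4.2 (arXiv p0012:L109–112)] -/
theorem proj_one_add_X_pow_smul (j n k : ℕ) (x : I.H) :
    I.proj n k ((1 + PowerSeries.X : IwasawaAlgebraO S) ^ j • x) = (cycLayerConjEndO S κ θ P n k i γ ^ j) (I.proj n k x) := by
  induction j generalizing x with
  | zero => rw [pow_zero, one_smul, pow_zero, AddMonoid.End.one_apply]
  | succ j ih =>
    rw [pow_succ, mul_smul, ih, pow_succ, AddMonoid.End.coe_mul, Function.comp_apply, add_smul, one_smul, map_add, I.proj_X_smul,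
      add_sub_cancel]
    rfl

/-- **`(1+T)^{pⁿ} − 1` kills the level `(n,k)`**, `i ≤ 2` (it acts as `conj_{γ^{pⁿ}} − 1` and `γ^{pⁿ} ∈ Gal(K̄/K_n)`). [cite: Lang1990, Ch. 5 §1] -/
theorem proj_one_add_X_pow_sub_one_smul (hi : i ≤ 2) (n k : ℕ) (x : I.H) :
    I.proj n k (((1 + PowerSeries.X : IwasawaAlgebraO S) ^ (p ^ n) - 1) • x) = 0 := by
  rw [sub_smul, one_smul, map_sub, proj_one_add_X_pow_smul, cycLayerConjEndO_pow_apply_eq_self S κ γ θ P n k hi, sub_self]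

/-- ★ **`(1+T)^x` (read in `Λ_𝒪` through `ℤ_p⟦T⟧ → 𝒪⟦T⟧`) acts on the level `(n,k)` as `conj_γ^{x mod pⁿ}`**, `i ≤ 2`, for every `p`-adic exponent `x`.
[cite: JohnsonLeungKings2011, §4.2 (arXiv p0012:L109–112)] [cite: Lang1990, Ch. 5 §1] [cite: NeukirchSchmidtWingberg2008, (5.3.5)] -/
theorem proj_binomialSeries_smul (hi : i ≤ 2) (x₁ : ℤ_[p]) (n k : ℕ) (x : I.H) :
    I.proj n k (iwasawaToIwasawaO S (binomialSeries ℤ_[p] x₁) • x) =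
      (cycLayerConjEndO S κ θ P n k i γ ^ (PadicInt.toZModPow n x₁).val) (I.proj n k x) := by
  obtain ⟨q, hq⟩ := exists_binomialSeries_sub_one_add_X_pow_val_eq n x₁
  rw [sub_eq_iff_eq_add'] at hq
  have hX : iwasawaToIwasawaO S (X : IwasawaAlgebra p) = (X : IwasawaAlgebraO S) := by
    rw [iwasawaToIwasawaO, PowerSeries.map_X]
  rw [hq]
  simp only [map_add, map_mul, map_pow, map_sub, map_one, hX]
  rw [add_smul, map_add, proj_one_add_X_pow_smul, mul_comm, mul_smul, I.proj_smul_eq_zero n k _ _ (proj_one_add_X_pow_sub_one_smul I hi n k x),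
    add_zero]

/-- ★★ **`(1+T)^x` acts on the level `(n,k)` as conjugation by ANY `g ∈ Γ_K` with `γ^{x mod pⁿ} g⁻¹ ∈ Gal(K̄/K_n)`** (`i ≤ 2`): the shape in which a Frobenius
`φ_w` is read as the group-like element `[φ_w] = (1+T)^{x_w}` of `Λ_𝒪`. [cite: JohnsonLeungKings2011, §5.1 (arXiv p0014:L12–20)] [cite: SerreLocalFields1979, VII §5 Prop. 3] -/
theorem proj_binomialSeries_smul_eq_cycLayerConjO (hi : i ≤ 2) {x₁ : ℤ_[p]} {n : ℕ} {g : absoluteGaloisGroup K}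
    (hg : γ ^ (PadicInt.toZModPow n x₁).val * g⁻¹ ∈ κ.layerSubgroup n) (k : ℕ) (x : I.H) :
    I.proj n k (iwasawaToIwasawaO S (binomialSeries ℤ_[p] x₁) • x) = cycLayerConjO S κ θ P n k i g (I.proj n k x) := by
  rw [proj_binomialSeries_smul I hi, cycLayerConjEndO, conjEndO_pow_apply, cycLayerConjO, ← inv_mul_cancel_right (γ ^ _) g, ← levelConjO_levelConjO,
    levelConjO_eq_self_of_mem S P θ hg (κ.isOpen_layerSubgroup n) k hi]

omit [NumberField K] in
/-- **Exponents exist when `κ γ` is a unit of `ℤ_p`** (e.g. `γ` or `γ⁻¹` a normalised topological generator): with `x = (κ γ)⁻¹ · κ g` one has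
`γ^{x mod pⁿ} g⁻¹ ∈ Gal(K̄/K_n)` for every `n`. [cite: Washington1997, §13.2] [cite: Lang1990, Ch. 5 §1] -/
theorem pow_toZModPow_val_mul_inv_mem_layerSubgroup {a : ℤ_[p]ˣ} (hγ : (κ γ).toAdd = a) (g : absoluteGaloisGroup K) (n : ℕ) :
    γ ^ (PadicInt.toZModPow n (((a⁻¹ : ℤ_[p]ˣ) : ℤ_[p]) * (κ g).toAdd)).val * g⁻¹ ∈ κ.layerSubgroup n := by
  rw [ZpExtension.mem_layerSubgroup, map_mul, map_inv, map_pow, toAdd_mul, toAdd_inv, toAdd_pow, hγ, nsmul_eq_mul]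
  -- `m · a - κ g = a · (m - a⁻¹ κ g)` with `m ≡ a⁻¹ κ g (mod pⁿ)`
  have hmem : ((PadicInt.toZModPow n (((a⁻¹ : ℤ_[p]ˣ) : ℤ_[p]) * (κ g).toAdd)).val : ℤ_[p]) - ((a⁻¹ : ℤ_[p]ˣ) : ℤ_[p]) * (κ g).toAdd ∈
      RingHom.ker (PadicInt.toZModPow n : ℤ_[p] →+* ZMod (p ^ n)) := by
    rw [RingHom.mem_ker, map_sub, map_natCast, ZMod.natCast_zmod_val, sub_self]
  rw [PadicInt.ker_toZModPow, Ideal.mem_span_singleton] at hmem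
  have h : ((PadicInt.toZModPow n (((a⁻¹ : ℤ_[p]ˣ) : ℤ_[p]) * (κ g).toAdd)).val : ℤ_[p]) * (a : ℤ_[p]) + -(κ g).toAdd =
      (a : ℤ_[p]) * (((PadicInt.toZModPow n (((a⁻¹ : ℤ_[p]ˣ) : ℤ_[p]) * (κ g).toAdd)).val : ℤ_[p]) - ((a⁻¹ : ℤ_[p]ˣ) : ℤ_[p]) * (κ g).toAdd) := by
    rw [mul_sub, ← mul_assoc, Units.mul_inv, one_mul, mul_comm]
    ring
  rw [← sub_eq_add_neg] at h ⊢
  rw [show ((PadicInt.toZModPow n (((a⁻¹ : ℤ_[p]ˣ) : ℤ_[p]) * (κ g).toAdd)).val : ℤ_[p]) * (a : ℤ_[p]) - (κ g).toAdd =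
      (a : ℤ_[p]) * (((PadicInt.toZModPow n (((a⁻¹ : ℤ_[p]ˣ) : ℤ_[p]) * (κ g).toAdd)).val : ℤ_[p]) - ((a⁻¹ : ℤ_[p]ˣ) : ℤ_[p]) * (κ g).toAdd) by
    rw [mul_sub, ← mul_assoc, Units.mul_inv, one_mul, mul_comm]]
  exact Dvd.dvd.mul_left hmem _

omit [NumberField K] in
/-- The case of a normalised topological generator: `κ γ = 1`. [cite: Washington1997, §13.2] -/
theorem pow_toZModPow_val_mul_inv_mem_layerSubgroup_of_isTopGenerator (hγ : κ.IsTopGenerator γ) (g : absoluteGaloisGroup K) (n : ℕ) :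
    γ ^ (PadicInt.toZModPow n (κ g).toAdd).val * g⁻¹ ∈ κ.layerSubgroup n := by
  have h := pow_toZModPow_val_mul_inv_mem_layerSubgroup (κ := κ) (γ := γ) (a := 1) (by rw [Units.val_one]; exact congrArg Multiplicative.toAdd hγ) g n
  simpa only [inv_one, Units.val_one, one_mul] using h

omit [NumberField K] in
/-- The case of the INVERSE of a normalised topological generator (`κ γ⁻¹ = −1`; honda's frame uses `γK⁻¹`). [cite: Washington1997, §13.2] -/
theorem inv_pow_toZModPow_val_mul_inv_mem_layerSubgroup_of_isTopGenerator (hγ : κ.IsTopGenerator γ) (g : absoluteGaloisGroup K) (n : ℕ) :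
    γ⁻¹ ^ (PadicInt.toZModPow n (-(κ g).toAdd)).val * g⁻¹ ∈ κ.layerSubgroup n := by
  have h := pow_toZModPow_val_mul_inv_mem_layerSubgroup (κ := κ) (γ := γ⁻¹) (a := -1)
    (by rw [map_inv, toAdd_inv, Units.val_neg, Units.val_one]; exact congrArg (fun t ↦ -Multiplicative.toAdd t) hγ) g n
  simpa only [inv_neg, inv_one, Units.val_neg, Units.val_one, neg_one_mul] using h

end Binomial

end Summit.BirchSwinnertonDyer.BirchSwinnertonDyer.Theorems.SmallImageRttJunctionLocal

end
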